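import Summits.QuantumFields.YangMills.Theorems.BalabanUVNodesN15CovariantAveragingHolonomy
import Summits.QuantumFields.YangMills.Theorems.BalabanUVNodesN15TwoSpacingGluingCurvedKnitSmallFieldDefect
import HarnessLib

/-!
# Route «BalabanUVNodes», node N15 = NE2, road (c) — PROGRAMME (P-Q), Vb: THE HOLONOMIES OF (125) AT TWO SPACINGS FIT — for a fine skew field `A′` with the (3.35) letters
# `‖A′‖ ≤ r_A`, `‖A′(b′ + e′) − A′(b′)‖ ≤ r_Aη′` and its block mean `Ā′ = gavgM π̂ A′`, the holonomy of `e^{η′A′}` along the fine path `(x′, L^ms + j)` and the holonomy of `e^{ηĀ′}`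
# along its projected coarse partner `(πx′, s + δ)` differ by `≤ C_d·r_A·η` (`η = L^{−k}`): the staircases by this seat's g4 `norm_stairProd_two_spacing_le`, the lines factor by factor

Cell `pub-ymgap`, seat `pub-ymgap-dag-n15-c` (generation g21; R134 (a) seat, strategy s1; HUMAN RULING D-0062; chair R424 venue).  `bears_on: R4∕N15 · K3⁸ SpineGivenEndpointR13SepCoPHV
(stmt-QuantumFields-27366)`; filed `--supports stmt-QuantumFields-27366 --as helper` — COUNT-NEUTRAL.  THEOREMS only ([folklore] lattice ∕ Banach-algebra bookkeeping), 0 `def`, 0 `sorry`.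
Imports BY NAME, nothing in the tree modified ∕ restated: n15-c∕185a `…CovariantAveragingHolonomy` (`holLeg`∕`holStair`∕`holLine`∕`holPath`, `conjTranspose_mprod_mul_self`; through it 181
`mprod`∕`mprod_add`∕`mprod_eq_oprod`), FILE 130 `…CurvedKnitSmallFieldDefect` (through it this seat's g4 `…ContourProducts`: `stairProd`, `legProd`, ★ `norm_stairProd_two_spacing_le`,
`exp_natCast_smul`; `…OrderedProducts`: `norm_oprod_sub_oprod_le`, `norm_oprod_sub_one_le`; dag-n15-a `kingPr`∕`kingPrV`∕`kingPr_val`∕`kingPr_bpt_hdig`∕`hdig`; n15-b `gavgM`∕`fit_blockAvgV`∕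
`norm_blockAvgV_le`∕`norm_exp_sub_exp_le`; (V4) `fibre_conn_kingPrV`; `Literature.Analysis.Calculus.norm_exp_sub_one_le`), Mathlib `CStarRing.norm_mem_unitary_mul`.

WHY.  n15-c∕184a∕184b bound the two-grid η-defects of the covariant averaging shapes by `(φ + 2B∕L^k)·e^{ρ′}e^{−ρ′d}` with `φ` the FIT between each fine kernel `cvaPath T′ (x′, L^ms + j)` and its
projected coarse partner `cvaPath T (πx′, s + δ)`; n15-c∕185a reduced `φ` to the HOLONOMY difference `‖U′(Γ′) − U(Γ)‖_{op}`.  THIS FILE bounds that difference in FILE 130's currency (fine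
`U′ = e^{η′A′}`, coarse `U = e^{ηĀ′}`, `Ā′ = gavgM π̂ A′`, `η = L^mη′`): the STAIRCASE part is this seat's g4 theorem verbatim (`holStair (e^{X}) = stairProd X`, `X′ = η′A′`, `L^m•X̃ = ηĀ′`,
fit `ω = η′Ω`, `Ω = 2(d+1)(L^m − 1)r_Aη′` the fibre oscillation); the LINE part: move the fine start `x′` back to the first fine point `x̂′` of its coarse cell (`c < L^m` steps, cost `e^{ηr_A} − 1`),
write the coarse line as `L^m(s + δ)` fine-step factors (`e^{ηĀ′} = (e^{η′Ā′})^{L^m}`), compare factor by factor (`π̂(x̂′ + te′) = πx′ + ⌊t∕L^m⌋e` exactly; each pair within `η′(Ω + 0)`), and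
absorb the `(c + j) mod L^m < L^m` surplus fine factors (`e^{ηr_A} − 1`).  Everything is `O(r_A·η)` — [Balaban1985BackgroundPropagators] (3.73)-type two-spacing comparison for the
averaging transports (mechanism; King's Prop. 3.9 shape), [Balaban1985Averaging] (126) «|(Q₀A)_c| ≤ |A|».

RESULTS ([folklore]).
* §1 `mprod_const`, `mprod_blocks`, `holLeg_exp`, `holStair_exp` (`= stairProd`), `holLine_add`, `holLine_exp_smul_natCast` (the coarse line as `L^m·N` fine-step factors),
  `kingPr_add_smul_of_dvd` (`π(x′ + te′) = πx′ + ⌊t∕L^m⌋e` when `L^m ∣ x′_μ`), `exists_cellStart`, `norm_sub_gavgM_kingPrV_le` (`‖A′(b′) − Ā′(π̂b′)‖ ≤ 2(d+1)(L^m−1)·r_Aη′`).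
* §2 `norm_unitary_mul_eq`∕`norm_mul_unitary_eq`, `norm_mprod_sub_one_le`∕`norm_mprod_sub_mprod_le`, `norm_exp_smul_sub_one_le`, ★ `norm_holStair_two_grid_le` (g4's bound verbatim: `3^{d+1}(d+1)(36 n′η′Ω + 9 L^mη′r_A)`);
  the line and the path are the sequel n15-c∕185c `…CovariantAveragingHolonomyLineFit`.

HONEST FRAMING ∕ LIMITS.  Bookkeeping for the MODEL transports of n15-c∕181 (main term (125), one-level staircase); FILE 130's small-field currency (skew `A′`, block-mean coarse field —
the linearised (C3) transport); crude constants.  NE2⁺ NOT PRINTED; N15 of record untouched (DISCHARGED AS CONSUMED); counts UNMOVED (typed 28∕28); one finite 𝕋⁴ at fixed ε per index — NOT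
infinite volume ∕ OS ∕ mass gap ∕ Clay.  Restate-immune (no Theses import).
-/

noncomputable section

open scoped BigOperators Matrix
open Finset NormedSpace

namespace Summit.QuantumFields.YangMills.BalabanUVNodes.N15.CovAvg

open Literature.MathematicalPhysics.QuantumFieldTheory.Balaban1983to89
open Literature.MathematicalPhysics.QuantumFieldTheory.Balaban1983to89.B5Prop11Plancherel (Tor fine unitVec)
open Literature.MathematicalPhysics.QuantumFieldTheory.Balaban1983to89.B5Block118 (bpt)
open Literature.MathematicalPhysics.QuantumFieldTheory.Balaban1983to89.B5Blocks16 (bpt_bijective)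
open Literature.MathematicalPhysics.QuantumFieldTheory.Balaban1983to89.B7Prop6Bound (oprod)
open Literature.Analysis.Calculus (norm_exp_sub_one_le)
open Summit.QuantumFields.YangMills.BalabanUVNodes.N15.VectorPiece (bondAt blockCoords blockCoords_bpt kingPr kingPrV kingPr_val kingPrV_eq kingPr_bpt_hdig hdig stairProd legProd
  norm_stairProd_two_spacing_le exp_natCast_smul norm_oprod_sub_oprod_le norm_oprod_sub_one_le oprod_congr oprod_succ fibre_conn_kingPrV bshiftEquiv bshiftEquiv_apply)
open Summit.QuantumFields.YangMills.BalabanUVNodes.N15.MatrixSpecies (fit_blockAvgV norm_blockAvgV_le norm_exp_sub_exp_le)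
open Summit.QuantumFields.YangMills.BalabanUVNodes.N15.BackgroundLayer (gavgM)
open Summit.QuantumFields.YangMills.BalabanUVNodes.N15.TwoGrid (kingPr_add_smul_unitVec_of_le)

variable {d : ℕ}

/-! ## §1 Product algebra, the cell start, the fibre oscillation -/

section Algebra

variable {R : Type} [Monoid R]

/-- A product of equal factors is a power. [folklore] -/
theorem mprod_const (H : R) (N : ℕ) : mprod (fun _ : ℕ => H) N = H ^ N := by
  induction N with
  | zero => simp
  | succ N ih => rw [mprod_succ, ih, pow_succ]

/-- Blocks: `Π_{s<A} Π_{j<B} H(sB + j) = Π_{t<AB} H(t)`. [folklore] -/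
theorem mprod_blocks (H : ℕ → R) (A B : ℕ) : mprod (fun s => mprod (fun j => H (s * B + j)) B) A = mprod H (A * B) := by
  induction A with
  | zero => simp
  | succ A ih => rw [mprod_succ, ih, Nat.succ_mul, mprod_add]

end Algebra

section Hol

open scoped Matrix.Norms.L2Operator

variable (M : Fin (d + 1) → ℕ) [∀ μ, NeZero (M μ)] (n : ℕ) [NeZero n] {mm : Type} [Fintype mm] [DecidableEq mm]

omit [∀ μ, NeZero (M μ)] in
/-- With exponential bond variables the leg holonomy IS g4's `legProd`. [folklore] -/
theorem holLeg_exp (X : Fin (d + 1) → Tor (fine n M) × Fin (d + 1) → Matrix mm mm ℂ) (y : Tor M) (a : Fin (d + 1) → Fin n) (μ ν : Fin (d + 1)) :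
    holLeg M n (fun μ b => exp (X μ b)) y a μ ν = legProd n M X y a μ ν := by
  unfold holLeg legProd
  induction (a μ : ℕ) with
  | zero => rfl
  | succ N ih =>
      rw [mprod_succ, oprod_succ]
      exact congrArg (fun P => P * exp (X μ (bondAt n M y a μ ν N))) ih

omit [∀ μ, NeZero (M μ)] in
/-- With exponential bond variables the staircase holonomy IS g4's `stairProd`. [folklore] -/
theorem holStair_exp (X : Fin (d + 1) → Tor (fine n M) × Fin (d + 1) → Matrix mm mm ℂ) (y : Tor M) (a : Fin (d + 1) → Fin n) (ν : Fin (d + 1)) :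
    holStair M n (fun μ b => exp (X μ b)) y a ν = stairProd n M X y a ν := by
  unfold holStair stairProd
  have hfac : ∀ i, (if h : i < d + 1 then holLeg M n (fun μ b => exp (X μ b)) y a ⟨i, h⟩ ν else 1) = (if h : i < d + 1 then legProd n M X y a ⟨i, h⟩ ν else 1) := fun i => by
    split_ifs with h
    · exact holLeg_exp M n X y a ⟨i, h⟩ ν
    · rfl
  have key : ∀ N, mprod (fun i => if h : i < d + 1 then holLeg M n (fun μ b => exp (X μ b)) y a ⟨i, h⟩ ν else 1) N =
      oprod (fun i => if h : i < d + 1 then legProd n M X y a ⟨i, h⟩ ν else 1) N := by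
    intro N
    induction N with
    | zero => rfl
    | succ N ih =>
        rw [mprod_succ, oprod_succ, hfac N]
        exact congrArg (fun P => P * (if h : N < d + 1 then legProd n M X y a ⟨N, h⟩ ν else 1)) ih
  exact key (d + 1)

omit [∀ μ, NeZero (M μ)] [NeZero n] in
/-- Concatenation of lines: `U([x, x + (c+s)e]) = U([x, x + ce])·U([x + ce, x + (c+s)e])`. [folklore] -/
theorem holLine_add (U : Fin (d + 1) → Tor (fine n M) × Fin (d + 1) → Matrix mm mm ℂ) (p : Tor (fine n M) × Fin (d + 1)) (c s : ℕ) :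
    holLine M n U p (c + s) = holLine M n U p c * holLine M n U (p.1 + c • unitVec (fine n M) p.2, p.2) s := by
  unfold holLine
  rw [mprod_add]
  congr 1
  refine mprod_congr fun i _ => ?_
  rw [add_smul, add_assoc]

omit [∀ μ, NeZero (M μ)] [NeZero n] in
/-- THE COARSE LINE AS FINE-STEP FACTORS: with `U = e^{R•X}` (`R : ℕ`), `U([z, z + Ne]) = Π_{t < R·N} e^{X(z + ⌊t∕R⌋e)}`. [folklore] -/
theorem holLine_exp_smul_natCast (X : Fin (d + 1) → Tor (fine n M) × Fin (d + 1) → Matrix mm mm ℂ) (R : ℕ) (hR : R ≠ 0) (z : Tor (fine n M)) (μ : Fin (d + 1)) (N : ℕ) :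
    holLine M n (fun ν b => exp (((R : ℕ) : ℝ) • X ν b)) (z, μ) N = mprod (fun t => exp (X μ (z + (t / R) • unitVec (fine n M) μ, μ))) (N * R) := by
  unfold holLine
  rw [← mprod_blocks]
  refine mprod_congr fun s _ => ?_
  dsimp only
  rw [exp_natCast_smul, ← mprod_const]
  refine mprod_congr fun j hj => ?_
  rw [show (s * R + j) / R = s by rw [Nat.add_comm, Nat.add_mul_div_right _ _ (Nat.pos_of_ne_zero hR), Nat.div_eq_of_lt hj, Nat.zero_add]]

end Hol

section Pairing

variable (M : Fin (d + 1) → ℕ) [∀ μ, NeZero (M μ)] (L k m : ℕ) [NeZero L]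

/-- KING's PAIRING FROM A CELL START: if `L^m ∣ x′_μ` then `π(x′ + t e′_μ) = πx′ + ⌊t∕L^m⌋·e_μ` for EVERY `t`. [cite: King1986, p.664 (pairing convention «x′ ∈ B^n(x)»)] -/
theorem kingPr_add_smul_of_dvd (x' : Tor (fine (L ^ m * L ^ k) M)) (μ : Fin (d + 1)) (hx : L ^ m ∣ (x' μ).val) (t : ℕ) :
    kingPr L k m M (x' + t • unitVec (fine (L ^ m * L ^ k) M) μ) = kingPr L k m M x' + (t / L ^ m) • unitVec (fine (L ^ k) M) μ := by
  have hLm : 0 < L ^ m := pow_pos (Nat.pos_of_ne_zero (NeZero.ne L)) m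
  funext ν
  by_cases hν : ν = μ
  · subst hν
    apply ZMod.val_injective
    rw [kingPr_val]
    have hstep : (x' + t • unitVec (fine (L ^ m * L ^ k) M) ν) ν = x' ν + (t : ZMod (fine (L ^ m * L ^ k) M ν)) := by simp [unitVec]
    have hval : ((x' + t • unitVec (fine (L ^ m * L ^ k) M) ν) ν).val = ((x' ν).val + t) % (L ^ m * L ^ k * M ν) := by
      rw [hstep, ZMod.val_add, ZMod.val_natCast, Nat.add_mod_mod]
    have hrhs : (kingPr L k m M x' + (t / L ^ m) • unitVec (fine (L ^ k) M) ν) ν = kingPr L k m M x' ν + ((t / L ^ m : ℕ) : ZMod (fine (L ^ k) M ν)) := by simp [unitVec]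
    rw [hval, hrhs, ZMod.val_add, ZMod.val_natCast, kingPr_val, show L ^ m * L ^ k * M ν = L ^ m * (L ^ k * M ν) from Nat.mul_assoc _ _ _,
      Nat.mod_mul_right_div_self, Nat.add_div_of_dvd_right hx, Nat.add_mod_mod]
  · have h1 : (x' + t • unitVec (fine (L ^ m * L ^ k) M) μ) ν = x' ν := by simp [unitVec, hν]
    have h2 : (kingPr L k m M x' + (t / L ^ m) • unitVec (fine (L ^ k) M) μ) ν = kingPr L k m M x' ν := by simp [unitVec, hν]
    rw [h2]
    apply ZMod.val_injective
    rw [kingPr_val, kingPr_val, h1]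

/-- THE CELL START: every fine point `x′` is `x̂′ + c e′_μ` with `c < L^m` and `L^m ∣ x̂′_μ`; then `πx̂′ = πx′`. [cite: King1986, p.664 (pairing convention)] -/
theorem exists_cellStart (x' : Tor (fine (L ^ m * L ^ k) M)) (μ : Fin (d + 1)) :
    ∃ (c : ℕ) (xh : Tor (fine (L ^ m * L ^ k) M)), c < L ^ m ∧ L ^ m ∣ (xh μ).val ∧ x' = xh + c • unitVec (fine (L ^ m * L ^ k) M) μ ∧ kingPr L k m M xh = kingPr L k m M x' := by
  have hLm : 0 < L ^ m := pow_pos (Nat.pos_of_ne_zero (NeZero.ne L)) m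
  set c : ℕ := (x' μ).val % L ^ m with hc
  have hcL : c < L ^ m := Nat.mod_lt _ hLm
  have hcle : c ≤ (x' μ).val := Nat.mod_le _ _
  set xh : Tor (fine (L ^ m * L ^ k) M) := x' - c • unitVec (fine (L ^ m * L ^ k) M) μ with hxh
  have hx' : x' = xh + c • unitVec (fine (L ^ m * L ^ k) M) μ := by rw [hxh, sub_add_cancel]
  have hval : (xh μ).val = (x' μ).val - c := by
    have hμ : xh μ = x' μ - (c : ZMod (fine (L ^ m * L ^ k) M μ)) := by simp [hxh, unitVec]
    have hclt : c < fine (L ^ m * L ^ k) M μ := by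
      have hpos : 0 < L ^ k * M μ := Nat.mul_pos (pow_pos (Nat.pos_of_ne_zero (NeZero.ne L)) k) (Nat.pos_of_ne_zero (NeZero.ne (M μ)))
      have hle : L ^ m ≤ L ^ m * L ^ k * M μ := by rw [Nat.mul_assoc]; exact Nat.le_mul_of_pos_right _ hpos
      exact lt_of_lt_of_le hcL hle
    have hcv : ((c : ZMod (fine (L ^ m * L ^ k) M μ))).val = c := by rw [ZMod.val_natCast, Nat.mod_eq_of_lt hclt]
    rw [hμ, ZMod.val_sub (by rw [hcv]; exact hcle), hcv]
  have hdvd : L ^ m ∣ (xh μ).val := by rw [hval, hc]; exact Nat.dvd_sub_mod _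
  refine ⟨c, xh, hcL, hdvd, hx', ?_⟩
  have h := kingPr_add_smul_of_dvd M L k m xh μ hdvd c
  rw [← hx', Nat.div_eq_of_lt hcL, zero_smul, add_zero] at h
  exact h.symm

variable {𝔄 : Type} [NormedAddCommGroup 𝔄] [NormedSpace ℝ 𝔄]

/-- THE FIBRE OSCILLATION LETTER: `‖A′(b′) − Ā′(π̂b′)‖ ≤ 2(d+1)(L^m−1)·β` for the block mean `Ā′ = gavgM π̂ A′` of a field with unit-step differences `≤ β` (n15-b `fit_blockAvgV` + (V4)
`fibre_conn_kingPrV`). [cite: Balaban1985BackgroundPropagators, (3.35) p.396 (shape: the background varies slowly over a block)] -/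
theorem norm_sub_gavgM_kingPrV_le {A' : Fin (d + 1) → Tor (fine (L ^ m * L ^ k) M) × Fin (d + 1) → 𝔄} {β : ℝ}
    (hstep : ∀ ν κ b', ‖A' ν (bshiftEquiv M (L ^ m * L ^ k) κ b') - A' ν b'‖ ≤ β) (ν : Fin (d + 1)) (b' : Tor (fine (L ^ m * L ^ k) M) × Fin (d + 1)) :
    ‖A' ν b' - gavgM 𝔄 (Fin (d + 1)) (kingPrV L k m M) A' ν (kingPrV L k m M b')‖ ≤ (2 * ((d + 1) * (L ^ m - 1)) : ℕ) * β :=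
  fit_blockAvgV (kingPrV L k m M) (a' := A' ν) (Ω := fun _ => ((2 * ((d + 1) * (L ^ m - 1)) : ℕ) : ℝ) * β)
    (fun b₁ b₂ h => fibre_conn_kingPrV (L := L) (k := k) (m := m) (M := M) (A' ν) β (hstep ν) b₁ b₂ h) b'

end Pairing

/-! ## §2 The staircase, the line and the path at two spacings -/

section TwoGrid

open scoped Matrix.Norms.L2Operator

variable {L : ℕ} [NeZero L] (M : Fin (d + 1) → ℕ) [∀ μ, NeZero (M μ)] (k m : ℕ) {mm : Type} [Fintype mm] [DecidableEq mm]

/-- `‖U·A‖ = ‖A‖` for unitary `U` (L²-operator norm). [folklore] -/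
theorem norm_unitary_mul_eq {U : Matrix mm mm ℂ} (hU : Uᴴ * U = 1) (A : Matrix mm mm ℂ) : ‖U * A‖ = ‖A‖ :=
  CStarRing.norm_mem_unitary_mul A (Matrix.mem_unitaryGroup_iff'.mpr (by rwa [Matrix.star_eq_conjTranspose]))

/-- `‖A·U‖ = ‖A‖` for unitary `U`. [folklore] -/
theorem norm_mul_unitary_eq {U : Matrix mm mm ℂ} (hU : Uᴴ * U = 1) (A : Matrix mm mm ℂ) : ‖A * U‖ = ‖A‖ :=
  CStarRing.norm_mul_mem_unitary A (Matrix.mem_unitaryGroup_iff'.mpr (by rwa [Matrix.star_eq_conjTranspose]))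

/-- `‖Π F − 1‖ ≤ (1+κ)^N − 1` for factors within `κ` of `1` (this seat's g4 `norm_oprod_sub_one_le` through `mprod_eq_oprod`). [folklore] -/
theorem norm_mprod_sub_one_le {F : ℕ → Matrix mm mm ℂ} {κ : ℝ} (hκ : 0 ≤ κ) {N : ℕ} (hF : ∀ i < N, ‖F i - 1‖ ≤ κ) : ‖mprod F N - 1‖ ≤ (1 + κ) ^ N - 1 := by
  rw [mprod_eq_oprod]; exact norm_oprod_sub_one_le hκ hF

/-- `‖Π F − Π G‖ ≤ (Σ‖F_i − G_i‖)(1+κ)^N` (g4 `norm_oprod_sub_oprod_le` through `mprod_eq_oprod`). [folklore] -/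
theorem norm_mprod_sub_mprod_le {F G : ℕ → Matrix mm mm ℂ} {κ : ℝ} (hκ : 0 ≤ κ) {N : ℕ} (hF : ∀ i < N, ‖F i - 1‖ ≤ κ) (hG : ∀ i < N, ‖G i - 1‖ ≤ κ) :
    ‖mprod F N - mprod G N‖ ≤ (∑ i ∈ range N, ‖F i - G i‖) * (1 + κ) ^ N := by
  rw [mprod_eq_oprod, mprod_eq_oprod]; exact norm_oprod_sub_oprod_le hκ hF hG

/-- one exponential factor: `‖e^{η′Z} − 1‖ ≤ e^{η′r} − 1` when `‖Z‖ ≤ r`, `η′ ≥ 0`. [folklore] -/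
theorem norm_exp_smul_sub_one_le {Z : Matrix mm mm ℂ} {η' r : ℝ} (hη' : 0 ≤ η') (hZ : ‖Z‖ ≤ r) : ‖exp (η' • Z) - 1‖ ≤ Real.exp (η' * r) - 1 := by
  refine (norm_exp_sub_one_le _).trans (sub_le_sub_right (Real.exp_le_exp.mpr ?_) 1)
  rw [norm_smul, Real.norm_of_nonneg hη']
  exact mul_le_mul_of_nonneg_left hZ hη'

/-- ★ **THE STAIRCASES AT TWO SPACINGS** (this seat's g4 `norm_stairProd_two_spacing_le` verbatim, `X′ = η′A′`, `L^m•X̃ = ηĀ′`, `ρ = η′r_A`, `ω = η′Ω`):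
`‖U′(Γ′_{y,a′}) − U(Γ_{y,⌊a′∕L^m⌋})‖ ≤ 3^{d+1}(d+1)(36 n′η′Ω + 9 L^mη′r_A)`, `Ω = 2(d+1)(L^m−1)·r_Aη′`. [cite: Balaban1985BackgroundPropagators, (3.73) p.405 (shape: the two-spacing comparison of transports)] -/
theorem norm_holStair_two_grid_le {A' : Fin (d + 1) → Tor (fine (L ^ m * L ^ k) M) × Fin (d + 1) → Matrix mm mm ℂ} {rA : ℝ} (hrA : 0 ≤ rA) (hrA1 : rA ≤ 1)
    (hA : ∀ μ b', ‖A' μ b'‖ ≤ rA) (hstep : ∀ μ κ b', ‖A' μ (bshiftEquiv M (L ^ m * L ^ k) κ b') - A' μ b'‖ ≤ rA * ((((L ^ m * L ^ k : ℕ) : ℝ))⁻¹))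
    (y : Tor M) (a' : Fin (d + 1) → Fin (L ^ m * L ^ k)) (ν : Fin (d + 1)) :
    ‖holStair M (L ^ m * L ^ k) (fun μ b => exp (((((L ^ m * L ^ k : ℕ) : ℝ))⁻¹) • A' μ b)) y a' ν -
        holStair M (L ^ k) (fun μ b => exp (((((L ^ k : ℕ) : ℝ))⁻¹) • gavgM (Matrix mm mm ℂ) (Fin (d + 1)) (kingPrV L k m M) A' μ b)) y (hdig L k m a') ν‖ ≤
      3 ^ (d + 1) * ((d + 1) * (36 * ((L ^ m * L ^ k : ℕ) : ℝ) * (((((L ^ m * L ^ k : ℕ) : ℝ))⁻¹) * ((2 * ((d + 1) * (L ^ m - 1)) : ℕ) * (rA * ((((L ^ m * L ^ k : ℕ) : ℝ))⁻¹)))) +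
        9 * (((L ^ m : ℕ) : ℝ) * (((((L ^ m * L ^ k : ℕ) : ℝ))⁻¹) * rA)))) := by
  have hLm0 : (0 : ℝ) < ((L ^ m : ℕ) : ℝ) := by exact_mod_cast pow_pos (Nat.pos_of_ne_zero (NeZero.ne L)) m
  have hn'0 : (0 : ℝ) < ((L ^ m * L ^ k : ℕ) : ℝ) := by exact_mod_cast Nat.mul_pos (pow_pos (Nat.pos_of_ne_zero (NeZero.ne L)) m) (pow_pos (Nat.pos_of_ne_zero (NeZero.ne L)) k)
  set η' : ℝ := ((((L ^ m * L ^ k : ℕ) : ℝ))⁻¹) with hη'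
  have hη'0 : 0 ≤ η' := inv_nonneg.mpr hn'0.le
  have hη : ((((L ^ k : ℕ) : ℝ))⁻¹) = ((L ^ m : ℕ) : ℝ) * η' := by
    rw [hη', Nat.cast_mul, mul_inv, ← mul_assoc, mul_inv_cancel₀ hLm0.ne', one_mul]
  have hco : (fun μ b => exp (((((L ^ k : ℕ) : ℝ))⁻¹) • gavgM (Matrix mm mm ℂ) (Fin (d + 1)) (kingPrV L k m M) A' μ b)) =
      (fun μ b => exp (((L ^ m : ℕ) : ℝ) • (η' • gavgM (Matrix mm mm ℂ) (Fin (d + 1)) (kingPrV L k m M) A' μ b))) := by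
    funext μ b; rw [smul_smul, ← hη]
  rw [hco, holStair_exp, holStair_exp]
  refine norm_stairProd_two_spacing_le (L := L) (k := k) (m := m) (M := M) (ρ := η' * rA) (mul_nonneg hη'0 hrA) (by positivity) ?_ ?_ ?_ ?_ y a' ν
  · rw [hη', mul_comm, ← mul_assoc, mul_inv_cancel₀ hn'0.ne', one_mul]; exact hrA1
  · intro μ b; rw [norm_smul, Real.norm_of_nonneg hη'0]; exact mul_le_mul_of_nonneg_left (hA μ b) hη'0
  · intro μ b; rw [norm_smul, Real.norm_of_nonneg hη'0]
    exact mul_le_mul_of_nonneg_left (norm_blockAvgV_le (kingPrV L k m M) hrA (hA μ) b) hη'0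
  · intro μ b'
    rw [← smul_sub, norm_smul, Real.norm_of_nonneg hη'0]
    exact mul_le_mul_of_nonneg_left (norm_sub_gavgM_kingPrV_le M L k m hstep μ b') hη'0


end TwoGrid

end Summit.QuantumFields.YangMills.BalabanUVNodes.N15.CovAvg

end
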